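import Summits.RiemannHypothesis.RiemannHypothesis.Theorems.SemilocalNegCertUptoHundredThirtySeven
import HarnessLib

/-!
**IMPORT NOTE (cc-s2-4 gen13).** Atom enclosures 107…128 and the log 113/131/137 bounds are cited from the located twins
`SemilocalLogAtomsJTwin` / `SemilocalLogAtomsKTwin` (declaration suffix `T`, identical rationals) because `SemilocalLogAtomsJ/K` have no hub olean
(dead-letter re-accept items); every kernel fact below is unchanged by the re-pointing.

# Semi-local threshold of the `{∞} ∪ {p < 139}` form, negative side: `a*({2,…,137}) ≤ 319/128` (the wall `q = 139`) — THE THEOREMS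

Second half of `SemilocalNegCertUptoHundredThirtySeven.lean` (split at 400 lines): the theorems read off the kernel facts of the certificate in that file (soundness `weilSemilocalThreshold_le_of_check{P,W}[_fast]_sharp`), the failure form, the window bound, the locality class and the bracket. See the first half for the instance data, the witness and the layout note.  Nothing here bears on RH.
-/

set_option autoImplicit false
set_option linter.dupNamespace false  -- the mandated namespace repeats `RiemannHypothesis`

noncomputable section

open Complex Filter Set MeasureTheory Topology
open scoped Real

namespace Summit.RiemannHypothesis.RiemannHypothesis.Theorems.SemilocalPolyWitness

open MeasureTheory Set Finset Real
open Literature.NumberTheory.LFunctions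
open Summit.RiemannHypothesis.RiemannHypothesis.Theorems.MotivicDoor
open Summit.RiemannHypothesis.RiemannHypothesis.Theorems.MotivicDoor.SemilocalThreshold
open Summit.RiemannHypothesis.RiemannHypothesis.Theorems.MotivicDoor.SemilocalMarkov
open LQ

/-! ### The theorems -/

/-- **`a*({2,…,137}) ≤ 319/128`.** -/
theorem weilSemilocalThreshold_uptoHundredThirtySeven_le :
    weilSemilocalThreshold {2, 3, 5, 7, 11, 13, 17, 19, 23, 29, 31, 37, 41, 43, 47, 53, 59, 61, 67, 71, 73, 79, 83, 89, 97, 101, 103, 107, 109, 113, 127, 131, 137} ≤ ((319 / 128 : ℚ) : ℝ) :=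
  weilSemilocalThreshold_le_of_checkW_fast_sharp certUptoHundredThirtySeven atomsEnclose_UptoHundredThirtySeven check_UptoHundredThirtySeven_main
    inc_UptoHundredThirtySeven check_UptoHundredThirtySeven_atoms check_UptoHundredThirtySeven_pieces

/-- Failure form: positivity of the `{∞} ∪ S_139` form fails on every cone `C(B)`, `B > 319/128`. -/
theorem not_weilSemilocalPositivityOn_uptoHundredThirtySeven_of_gt {B : ℝ} (hB : (319 / 128 : ℝ) < B) :
    ¬ WeilSemilocalPositivityOn {2, 3, 5, 7, 11, 13, 17, 19, 23, 29, 31, 37, 41, 43, 47, 53, 59, 61, 67, 71, 73, 79, 83, 89, 97, 101, 103, 107, 109, 113, 127, 131, 137} B := by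
  rw [not_weilSemilocalPositivityOn_iff_weilSemilocalThreshold_lt]
  have h := weilSemilocalThreshold_uptoHundredThirtySeven_le
  push_cast at h
  linarith

/-- `a*({2,…,137}) < (log 149)/2`: below the window of the next index. -/
theorem weilSemilocalThreshold_uptoHundredThirtySeven_lt_log_hundredfortynine_half :
    weilSemilocalThreshold {2, 3, 5, 7, 11, 13, 17, 19, 23, 29, 31, 37, 41, 43, 47, 53, 59, 61, 67, 71, 73, 79, 83, 89, 97, 101, 103, 107, 109, 113, 127, 131, 137} < Real.log 149 / 2 := by
  have h := weilSemilocalThreshold_uptoHundredThirtySeven_le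
  have hsucc := logHundredFortyNineLo11_le
  rw [logHundredFortyNineLo11] at hsucc
  push_cast at hsucc h
  linarith

set_option maxHeartbeats 1600000 in  -- 149-way `interval_cases` with 33-prime membership simps
/-- **The class `2, …, 137 ∈ S ∌ 139`**: `a*(S) = a*({2,…,137})` (locality at `N = 148`). -/
theorem weilSemilocalThreshold_eq_uptoHundredThirtySeven {S : Finset ℕ} (h2 : 2 ∈ S) (h3 : 3 ∈ S) (h5 : 5 ∈ S) (h7 : 7 ∈ S) (h11 : 11 ∈ S) (h13 : 13 ∈ S) (h17 : 17 ∈ S) (h19 : 19 ∈ S) (h23 : 23 ∈ S) (h29 : 29 ∈ S) (h31 : 31 ∈ S) (h37 : 37 ∈ S) (h41 : 41 ∈ S) (h43 : 43 ∈ S) (h47 : 47 ∈ S) (h53 : 53 ∈ S) (h59 : 59 ∈ S) (h61 : 61 ∈ S) (h67 : 67 ∈ S) (h71 : 71 ∈ S) (h73 : 73 ∈ S) (h79 : 79 ∈ S) (h83 : 83 ∈ S) (h89 : 89 ∈ S) (h97 : 97 ∈ S) (h101 : 101 ∈ S) (h103 : 103 ∈ S) (h107 : 107 ∈ S) (h109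 : 109 ∈ S) (h113 : 113 ∈ S) (h127 : 127 ∈ S) (h131 : 131 ∈ S) (h137 : 137 ∈ S)
    (h139 : 139 ∉ S) : weilSemilocalThreshold S = weilSemilocalThreshold {2, 3, 5, 7, 11, 13, 17, 19, 23, 29, 31, 37, 41, 43, 47, 53, 59, 61, 67, 71, 73, 79, 83, 89, 97, 101, 103, 107, 109, 113, 127, 131, 137} := by
  refine weilSemilocalThreshold_congr (S := {2, 3, 5, 7, 11, 13, 17, 19, 23, 29, 31, 37, 41, 43, 47, 53, 59, 61, 67, 71, 73, 79, 83, 89, 97, 101, 103, 107, 109, 113, 127, 131, 137}) (S' := S) (N := 148) ?_ ?_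
  · intro n hn hpp
    interval_cases n
    · exact absurd hpp (by decide)
    · exact absurd hpp (by decide)
    · rw [Nat.prime_two.primeFactors]; simp [h2]
    · rw [Nat.prime_three.primeFactors]; simp [h3]
    · rw [show (4 : ℕ) = 2 ^ 2 by norm_num, Nat.primeFactors_prime_pow two_ne_zero Nat.prime_two]; simp [h2]
    · rw [(by norm_num : Nat.Prime 5).primeFactors]; simp [h5]
    · exact absurd hpp (by decide)
    · rw [(by norm_num : Nat.Prime 7).primeFactors]; simp [h7]
    · rw [show (8 : ℕ) = 2 ^ 3 by norm_num, Nat.primeFactors_prime_pow (by norm_num) Nat.prime_two]; simp [h2]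
    · rw [show (9 : ℕ) = 3 ^ 2 by norm_num, Nat.primeFactors_prime_pow two_ne_zero Nat.prime_three]; simp [h3]
    · exact absurd hpp (by decide)
    · rw [(by norm_num : Nat.Prime 11).primeFactors]; simp [h11]
    · exact absurd hpp (by decide)
    · rw [(by norm_num : Nat.Prime 13).primeFactors]; simp [h13]
    · exact absurd hpp (by decide)
    · exact absurd hpp (not_isPrimePow_of_two_primes_dvd Nat.prime_three (by norm_num : Nat.Prime 5) (by norm_num)
        (by norm_num) (by norm_num))
    · rw [show (16 : ℕ) = 2 ^ 4 by norm_num, Nat.primeFactors_prime_pow (by norm_num) Nat.prime_two]; simp [h2]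
    · rw [(by norm_num : Nat.Prime 17).primeFactors]; simp [h17]
    · exact absurd hpp (by decide)
    · rw [(by norm_num : Nat.Prime 19).primeFactors]; simp [h19]
    · exact absurd hpp (by decide)
    · exact absurd hpp (not_isPrimePow_of_two_primes_dvd Nat.prime_three (by norm_num : Nat.Prime 7) (by norm_num)
        (by norm_num) (by norm_num))
    · exact absurd hpp (by decide)
    · rw [(by norm_num : Nat.Prime 23).primeFactors]; simp [h23]
    · exact absurd hpp (by decide)
    · rw [show (25 : ℕ) = 5 ^ 2 by norm_num, Nat.primeFactors_prime_pow two_ne_zero (by norm_num : Nat.Prime 5)]; simp [h5]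
    · exact absurd hpp (by decide)
    · rw [show (27 : ℕ) = 3 ^ 3 by norm_num, Nat.primeFactors_prime_pow (by norm_num) Nat.prime_three]; simp [h3]
    · exact absurd hpp (by decide)
    · rw [(by norm_num : Nat.Prime 29).primeFactors]; simp [h29]
    · exact absurd hpp (by decide)
    · rw [(by norm_num : Nat.Prime 31).primeFactors]; simp [h31]
    · rw [show (32 : ℕ) = 2 ^ 5 by norm_num, Nat.primeFactors_prime_pow (by norm_num) Nat.prime_two]; simp [h2]
    · exact absurd hpp (not_isPrimePow_of_two_primes_dvd Nat.prime_three (by norm_num : Nat.Prime 11) (by norm_num)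
        (by norm_num) (by norm_num))
    · exact absurd hpp (by decide)
    · exact absurd hpp (not_isPrimePow_of_two_primes_dvd (by norm_num : Nat.Prime 5) (by norm_num : Nat.Prime 7) (by norm_num)
        (by norm_num) (by norm_num))
    · exact absurd hpp (by decide)
    · rw [(by norm_num : Nat.Prime 37).primeFactors]; simp [h37]
    · exact absurd hpp (by decide)
    · exact absurd hpp (not_isPrimePow_of_two_primes_dvd Nat.prime_three (by norm_num : Nat.Prime 13) (by norm_num)
        (by norm_num) (by norm_num))
    · exact absurd hpp (by decide)
    · rw [(by norm_num : Nat.Prime 41).primeFactors]; simp [h41]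
    · exact absurd hpp (by decide)
    · rw [(by norm_num : Nat.Prime 43).primeFactors]; simp [h43]
    · exact absurd hpp (by decide)
    · exact absurd hpp (not_isPrimePow_of_two_primes_dvd Nat.prime_three (by norm_num : Nat.Prime 5) (by norm_num)
        (by norm_num) (by norm_num))
    · exact absurd hpp (by decide)
    · rw [(by norm_num : Nat.Prime 47).primeFactors]; simp [h47]
    · exact absurd hpp (by decide)
    · rw [show (49 : ℕ) = 7 ^ 2 by norm_num, Nat.primeFactors_prime_pow two_ne_zero (by norm_num : Nat.Prime 7)]; simp [h7]
    · exact absurd hpp (by decide)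
    · exact absurd hpp (not_isPrimePow_of_two_primes_dvd Nat.prime_three (by norm_num : Nat.Prime 17) (by norm_num)
        (by norm_num) (by norm_num))
    · exact absurd hpp (by decide)
    · rw [(by norm_num : Nat.Prime 53).primeFactors]; simp [h53]
    · exact absurd hpp (by decide)
    · exact absurd hpp (not_isPrimePow_of_two_primes_dvd (by norm_num : Nat.Prime 5) (by norm_num : Nat.Prime 11) (by norm_num)
        (by norm_num) (by norm_num))
    · exact absurd hpp (by decide)
    · exact absurd hpp (not_isPrimePow_of_two_primes_dvd Nat.prime_three (by norm_num : Nat.Prime 19) (by norm_num)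
        (by norm_num) (by norm_num))
    · exact absurd hpp (by decide)
    · rw [(by norm_num : Nat.Prime 59).primeFactors]; simp [h59]
    · exact absurd hpp (by decide)
    · rw [(by norm_num : Nat.Prime 61).primeFactors]; simp [h61]
    · exact absurd hpp (by decide)
    · exact absurd hpp (not_isPrimePow_of_two_primes_dvd Nat.prime_three (by norm_num : Nat.Prime 7) (by norm_num)
        (by norm_num) (by norm_num))
    · rw [show (64 : ℕ) = 2 ^ 6 by norm_num, Nat.primeFactors_prime_pow (by norm_num) Nat.prime_two]; simp [h2]
    · exact absurd hpp (not_isPrimePow_of_two_primes_dvd (by norm_num : Nat.Prime 5) (by norm_num : Nat.Prime 13) (by norm_num)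
        (by norm_num) (by norm_num))
    · exact absurd hpp (by decide)
    · rw [(by norm_num : Nat.Prime 67).primeFactors]; simp [h67]
    · exact absurd hpp (by decide)
    · exact absurd hpp (not_isPrimePow_of_two_primes_dvd Nat.prime_three (by norm_num : Nat.Prime 23) (by norm_num)
        (by norm_num) (by norm_num))
    · exact absurd hpp (by decide)
    · rw [(by norm_num : Nat.Prime 71).primeFactors]; simp [h71]
    · exact absurd hpp (by decide)
    · rw [(by norm_num : Nat.Prime 73).primeFactors]; simp [h73]
    · exact absurd hpp (by decide)
    · exact absurd hpp (not_isPrimePow_of_two_primes_dvd Nat.prime_three (by norm_num : Nat.Prime 5) (by norm_num)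
        (by norm_num) (by norm_num))
    · exact absurd hpp (by decide)
    · exact absurd hpp (not_isPrimePow_of_two_primes_dvd (by norm_num : Nat.Prime 7) (by norm_num : Nat.Prime 11) (by norm_num)
        (by norm_num) (by norm_num))
    · exact absurd hpp (by decide)
    · rw [(by norm_num : Nat.Prime 79).primeFactors]; simp [h79]
    · exact absurd hpp (by decide)
    · rw [show (81 : ℕ) = 3 ^ 4 by norm_num, Nat.primeFactors_prime_pow (by norm_num) Nat.prime_three]; simp [h3]
    · exact absurd hpp (by decide)
    · rw [(by norm_num : Nat.Prime 83).primeFactors]; simp [h83]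
    · exact absurd hpp (by decide)
    · exact absurd hpp (not_isPrimePow_of_two_primes_dvd (by norm_num : Nat.Prime 5) (by norm_num : Nat.Prime 17) (by norm_num)
        (by norm_num) (by norm_num))
    · exact absurd hpp (by decide)
    · exact absurd hpp (not_isPrimePow_of_two_primes_dvd Nat.prime_three (by norm_num : Nat.Prime 29) (by norm_num)
        (by norm_num) (by norm_num))
    · exact absurd hpp (by decide)
    · rw [(by norm_num : Nat.Prime 89).primeFactors]; simp [h89]
    · exact absurd hpp (by decide)
    · exact absurd hpp (not_isPrimePow_of_two_primes_dvd (by norm_num : Nat.Prime 7) (by norm_num : Nat.Prime 13) (by norm_num)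
        (by norm_num) (by norm_num))
    · exact absurd hpp (by decide)
    · exact absurd hpp (not_isPrimePow_of_two_primes_dvd Nat.prime_three (by norm_num : Nat.Prime 31) (by norm_num)
        (by norm_num) (by norm_num))
    · exact absurd hpp (by decide)
    · exact absurd hpp (not_isPrimePow_of_two_primes_dvd (by norm_num : Nat.Prime 5) (by norm_num : Nat.Prime 19) (by norm_num)
        (by norm_num) (by norm_num))
    · exact absurd hpp (by decide)
    · rw [(by norm_num : Nat.Prime 97).primeFactors]; simp [h97]
    · exact absurd hpp (by decide)
    · exact absurd hpp (not_isPrimePow_of_two_primes_dvd Nat.prime_three (by norm_num : Nat.Prime 11) (by norm_num)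
        (by norm_num) (by norm_num))
    · exact absurd hpp (by decide)
    · rw [(by norm_num : Nat.Prime 101).primeFactors]; simp [h101]
    · exact absurd hpp (by decide)
    · rw [(by norm_num : Nat.Prime 103).primeFactors]; simp [h103]
    · exact absurd hpp (by decide)
    · exact absurd hpp (not_isPrimePow_of_two_primes_dvd Nat.prime_three (by norm_num : Nat.Prime 5) (by norm_num)
        (by norm_num) (by norm_num))
    · exact absurd hpp (by decide)
    · rw [(by norm_num : Nat.Prime 107).primeFactors]; simp [h107]
    · exact absurd hpp (by decide)
    · rw [(by norm_num : Nat.Prime 109).primeFactors]; simp [h109]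
    · exact absurd hpp (by decide)
    · exact absurd hpp (not_isPrimePow_of_two_primes_dvd Nat.prime_three (by norm_num : Nat.Prime 37) (by norm_num)
        (by norm_num) (by norm_num))
    · exact absurd hpp (by decide)
    · rw [(by norm_num : Nat.Prime 113).primeFactors]; simp [h113]
    · exact absurd hpp (by decide)
    · exact absurd hpp (not_isPrimePow_of_two_primes_dvd (by norm_num : Nat.Prime 5) (by norm_num : Nat.Prime 23) (by norm_num)
        (by norm_num) (by norm_num))
    · exact absurd hpp (by decide)
    · exact absurd hpp (not_isPrimePow_of_two_primes_dvd Nat.prime_three (by norm_num : Nat.Prime 13) (by norm_num)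
        (by norm_num) (by norm_num))
    · exact absurd hpp (by decide)
    · exact absurd hpp (not_isPrimePow_of_two_primes_dvd (by norm_num : Nat.Prime 7) (by norm_num : Nat.Prime 17) (by norm_num)
        (by norm_num) (by norm_num))
    · exact absurd hpp (by decide)
    · rw [show (121 : ℕ) = 11 ^ 2 by norm_num, Nat.primeFactors_prime_pow two_ne_zero (by norm_num : Nat.Prime 11)]; simp [h11]
    · exact absurd hpp (by decide)
    · exact absurd hpp (not_isPrimePow_of_two_primes_dvd Nat.prime_three (by norm_num : Nat.Prime 41) (by norm_num)
        (by norm_num) (by norm_num))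
    · exact absurd hpp (by decide)
    · rw [show (125 : ℕ) = 5 ^ 3 by norm_num, Nat.primeFactors_prime_pow (by norm_num) (by norm_num : Nat.Prime 5)]; simp [h5]
    · exact absurd hpp (by decide)
    · rw [(by norm_num : Nat.Prime 127).primeFactors]; simp [h127]
    · rw [show (128 : ℕ) = 2 ^ 7 by norm_num, Nat.primeFactors_prime_pow (by norm_num) Nat.prime_two]; simp [h2]
    · exact absurd hpp (not_isPrimePow_of_two_primes_dvd Nat.prime_three (by norm_num : Nat.Prime 43) (by norm_num)
        (by norm_num) (by norm_num))
    · exact absurd hpp (by decide)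
    · rw [(by norm_num : Nat.Prime 131).primeFactors]; simp [h131]
    · exact absurd hpp (by decide)
    · exact absurd hpp (not_isPrimePow_of_two_primes_dvd (by norm_num : Nat.Prime 7) (by norm_num : Nat.Prime 19) (by norm_num)
        (by norm_num) (by norm_num))
    · exact absurd hpp (by decide)
    · exact absurd hpp (not_isPrimePow_of_two_primes_dvd Nat.prime_three (by norm_num : Nat.Prime 5) (by norm_num)
        (by norm_num) (by norm_num))
    · exact absurd hpp (by decide)
    · rw [(by norm_num : Nat.Prime 137).primeFactors]; simp [h137]
    · exact absurd hpp (by decide)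
    · rw [(by norm_num : Nat.Prime 139).primeFactors]; simp [h139]
    · exact absurd hpp (by decide)
    · exact absurd hpp (not_isPrimePow_of_two_primes_dvd Nat.prime_three (by norm_num : Nat.Prime 47) (by norm_num)
        (by norm_num) (by norm_num))
    · exact absurd hpp (by decide)
    · exact absurd hpp (not_isPrimePow_of_two_primes_dvd (by norm_num : Nat.Prime 11) (by norm_num : Nat.Prime 13) (by norm_num)
        (by norm_num) (by norm_num))
    · exact absurd hpp (by decide)
    · exact absurd hpp (not_isPrimePow_of_two_primes_dvd (by norm_num : Nat.Prime 5) (by norm_num : Nat.Prime 29) (by norm_num)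
        (by norm_num) (by norm_num))
    · exact absurd hpp (by decide)
    · exact absurd hpp (not_isPrimePow_of_two_primes_dvd Nat.prime_three (by norm_num : Nat.Prime 7) (by norm_num)
        (by norm_num) (by norm_num))
    · exact absurd hpp (by decide)
  · have h := weilSemilocalThreshold_uptoHundredThirtySeven_lt_log_hundredfortynine_half
    norm_num
    exact h

/-- **`a*(S) ≤ 319/128` for every finite set of primes `S` with `2, …, 137 ∈ S`, `139 ∉ S`.** -/
theorem weilSemilocalThreshold_le_of_mem_hundredthirtyseven {S : Finset ℕ} (h2 : 2 ∈ S) (h3 : 3 ∈ S) (h5 : 5 ∈ S) (h7 : 7 ∈ S) (h11 : 11 ∈ S) (h13 : 13 ∈ S) (h17 : 17 ∈ S) (h19 : 19 ∈ S) (h23 : 23 ∈ S) (h29 : 29 ∈ S) (h31 : 31 ∈ S) (h37 : 37 ∈ S) (h41 : 41 ∈ S) (h43 : 43 ∈ S) (h47 : 47 ∈ S) (h53 : 53 ∈ S) (h59 : 59 ∈ S) (h61 : 61 ∈ S) (h67 : 67 ∈ S) (h71 : 71 ∈ S) (h73 : 73 ∈ S) (h79 : 79 ∈ S) (h83 : 83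 ∈ S) (h89 : 89 ∈ S) (h97 : 97 ∈ S) (h101 : 101 ∈ S) (h103 : 103 ∈ S) (h107 : 107 ∈ S) (h109 : 109 ∈ S) (h113 : 113 ∈ S) (h127 : 127 ∈ S) (h131 : 131 ∈ S) (h137 : 137 ∈ S)
    (h139 : 139 ∉ S) : weilSemilocalThreshold S ≤ ((319 / 128 : ℚ) : ℝ) := by
  rw [weilSemilocalThreshold_eq_uptoHundredThirtySeven h2 h3 h5 h7 h11 h13 h17 h19 h23 h29 h31 h37 h41 h43 h47 h53 h59 h61 h67 h71 h73 h79 h83 h89 h97 h101 h103 h107 h109 h113 h127 h131 h137 h139]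
  exact weilSemilocalThreshold_uptoHundredThirtySeven_le

/-- **The bracket of the class `2, …, 137 ∈ S ∌ 139`**: `4023/5000 ≤ a*(S) ≤ 319/128` (no DATA row; finder: `a*(S_139) ≈ −1.0e-3 / −2.3e-3 at 639/256`). -/
theorem weilSemilocalThreshold_mem_Icc_of_mem_hundredthirtyseven {S : Finset ℕ} (h2 : 2 ∈ S) (h3 : 3 ∈ S) (h5 : 5 ∈ S) (h7 : 7 ∈ S) (h11 : 11 ∈ S) (h13 : 13 ∈ S) (h17 : 17 ∈ S) (h19 : 19 ∈ S) (h23 : 23 ∈ S) (h29 : 29 ∈ S) (h31 : 31 ∈ S) (h37 : 37 ∈ S) (h41 : 41 ∈ S) (h43 : 43 ∈ S) (h47 : 47 ∈ S) (h53 : 53 ∈ S) (h59 : 59 ∈ S) (h61 : 61 ∈ S) (h67 : 67 ∈ S) (h71 : 71 ∈ S) (h73 : 73 ∈ S) (h79 : 79 ∈ S) (h83 : 83 ∈ S) (h89 : 89 ∈ S) (h97 : 97 ∈ S) (h101 : 101 ∈ S) (h103 : 103 ∈ S) (h107 : 107 ∈ S) (h109 : 109 ∈ S) (h113 : 113 ∈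 S) (h127 : 127 ∈ S) (h131 : 131 ∈ S) (h137 : 137 ∈ S)
    (h139 : 139 ∉ S) : weilSemilocalThreshold S ∈ Set.Icc (4023 / 5000 : ℝ) ((319 / 128 : ℚ) : ℝ) :=
  ⟨SemilocalTwoThree.le_weilSemilocalThreshold_of_two_three_8046 h2 h3,
    weilSemilocalThreshold_le_of_mem_hundredthirtyseven h2 h3 h5 h7 h11 h13 h17 h19 h23 h29 h31 h37 h41 h43 h47 h53 h59 h61 h67 h71 h73 h79 h83 h89 h97 h101 h103 h107 h109 h113 h127 h131 h137 h139⟩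

end Summit.RiemannHypothesis.RiemannHypothesis.Theorems.SemilocalPolyWitness

end
-- 2026-08-26T12:3xZ weil-1 gen20: byte-identical re-land to refresh the stranded hub olean (gate5 build-queue workaround; director-rh 12:16:38Z); no content change.
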